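import Mathlib
import Literature.Computability.AlgebraicComplexity.PrattTrapezoidVal
import Literature.Combinatorics.Additive.SliceRankMethod

/-!
# A trapezoid-free triple is a tricolored sum-free set in `G × G` (and why this is void)

K. Pratt, arXiv:2309.03878, Def. 3.2 (tree `IsEquilateralTrapezoidFree`, `zeroSumTriples`,
`prattVal`); Blasiak–Church–Cohn–Grochow–Naslund–Sawin–Umans 2017 (tree `IsTricoloredSumFree`).

**The bridge** (`isTricoloredSumFree`).  Let `(A, B, C)` be subsets of an abelian group `G`
satisfying ONLY THE FIRST of Pratt's three systems (for fixed `a' ∈ A`, `b' ∈ B` at most one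
`(a, b, c) ∈ A × B × C` with `a' + b + c = 0 = a + b' + c`), and let `S` be the set of ALL solutions
of `a + b + c = 0` in `A × B × C`.  Index by `e = (a, b, c) ∈ S` the three vectors
`s_e = (a, b)`, `t_e = (c, a)`, `u_e = (b, c)` of `G × G`.  Then `(s, t, u)` is a tricolored
sum-free set: `s_i + t_j + u_k = (a_i + c_j + b_k, b_i + a_j + c_k)` vanishes iff
`(a_i, b_k, c_j)` and `(a_j, b_i, c_k)` are solutions; system 1 at `(a_j, b_k)` compares the
solutions `(a_i, b_j, c_j)` and `(a_k, b_i, c_k)` of its two equations and gives `a_i = a_k`,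
`b_j = b_i`, `c_j = c_k`; then system 1 at `(a_i, b_i)` compares `(a_i, b_i, c_i)` with
`(a_j, b_k, c_j)` and gives `a_i = a_j`, `b_i = b_k`; so `i = j = k`.  Hence
(`card_zeroSumTriples_le_of_tsf_bound`) every upper bound for tricolored sum-free sets in `G × G`
bounds the solution count, in particular `Val(G)`.

**Why it is quantitatively void** (recorded so that nobody re-derives it): by the slice-rank
method a tricolored sum-free set in `𝔽_q^{2n}` has size `≤ 3(θ_q q)^{2n}` (tree
`IsTricoloredSumFree.card_le_of_addEquiv`), i.e. `≤ 3|G|^{2(1 − c_q)}` for `G = 𝔽_q^n`, and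
`2(1 − c_q) ≈ 1.84 (q = 3), 1.84 (q = 2)` exceeds the trivial exponent `3/2` of Pratt's Prop. 3.4;
moreover tricolored sum-free sets of size `(θ_q q)^{m(1−o(1))}` exist in `𝔽_q^m`
(Kleinberg–Sawin–Speyer 2018, Norin, Pebody), so NO improvement of the tricolored bound can turn this
bridge into a power saving for `Val`.  Index sets of pairs of solutions sharing a point (size
`≥ T²/|G|`, which would suffice numerically in `G × G`) admit no three injective zero-summing views
into `G × G`: the shared point supplies only one coordinate of its type.  (Gate `gate-prattval`,
gen-14, RESULTS §K.)  Only system 1 is used; line-inducedness enters because `S` is the set of ALL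
solutions.

No bearing on `ω`.
-/

set_option linter.dupNamespace false

namespace Summit.MatrixMultiplication.MatrixMultiplication.Theorems

open Finset Literature.Computability.AlgebraicComplexity Literature.Combinatorics.Additive

namespace PrattValTricolored

universe u

variable {G : Type u} [AddCommGroup G] [DecidableEq G]

/-- System 1 of Def. 3.2 as an equality of solution triples: two triples of `A × B × C` solving
`a' + b + c = 0 = a + b' + c` for the same `(a', b')` coincide. -/
theorem sys₁_eq {A B C : Finset G}
    (h1 : ∀ a' ∈ A, ∀ b' ∈ B,
      #((A ×ˢ B ×ˢ C).filter fun t => a' + t.2.1 + t.2.2 = 0 ∧ t.1 + b' + t.2.2 = 0) ≤ 1)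
    {a' b' : G} (ha' : a' ∈ A) (hb' : b' ∈ B) {x y : G × G × G}
    (hx : x.1 ∈ A ∧ x.2.1 ∈ B ∧ x.2.2 ∈ C) (hx1 : a' + x.2.1 + x.2.2 = 0) (hx2 : x.1 + b' + x.2.2 = 0)
    (hy : y.1 ∈ A ∧ y.2.1 ∈ B ∧ y.2.2 ∈ C) (hy1 : a' + y.2.1 + y.2.2 = 0) (hy2 : y.1 + b' + y.2.2 = 0) :
    x = y := by
  refine Finset.card_le_one.1 (h1 a' ha' b' hb') x ?_ y ?_
  · exact mem_filter.2 ⟨mem_product.2 ⟨hx.1, mem_product.2 ⟨hx.2.1, hx.2.2⟩⟩, hx1, hx2⟩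
  · exact mem_filter.2 ⟨mem_product.2 ⟨hy.1, mem_product.2 ⟨hy.2.1, hy.2.2⟩⟩, hy1, hy2⟩

/-- **The bridge.**  If `(A, B, C)` satisfies system 1 of Pratt's Def. 3.2, then the solutions
`e = (a, b, c)` of `a + b + c = 0` in `A × B × C`, viewed three times in `G × G` as
`s_e = (a, b)`, `t_e = (c, a)`, `u_e = (b, c)`, form a tricolored sum-free set (BCCGNSU 2017):
`s_i + t_j + u_k = 0 ↔ i = j = k`. -/
theorem isTricoloredSumFree {A B C : Finset G}
    (h1 : ∀ a' ∈ A, ∀ b' ∈ B,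
      #((A ×ˢ B ×ˢ C).filter fun t => a' + t.2.1 + t.2.2 = 0 ∧ t.1 + b' + t.2.2 = 0) ≤ 1) :
    IsTricoloredSumFree
      (fun e : zeroSumTriples A B C => ((e : G × G × G).1, (e : G × G × G).2.1))
      (fun e : zeroSumTriples A B C => ((e : G × G × G).2.2, (e : G × G × G).1))
      (fun e : zeroSumTriples A B C => ((e : G × G × G).2.1, (e : G × G × G).2.2)) := by
  intro i j k
  obtain ⟨⟨ai, bi, ci⟩, hi⟩ := i
  obtain ⟨⟨aj, bj, cj⟩, hj⟩ := j
  obtain ⟨⟨ak, bk, ck⟩, hk⟩ := k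
  obtain ⟨⟨hai, hbi, hci⟩, hsi⟩ := mem_zeroSumTriples.1 hi
  obtain ⟨⟨haj, hbj, hcj⟩, hsj⟩ := mem_zeroSumTriples.1 hj
  obtain ⟨⟨hak, hbk, hck⟩, hsk⟩ := mem_zeroSumTriples.1 hk
  simp only at hsi hsj hsk
  constructor
  · intro h
    simp only [Prod.mk_add_mk, Prod.mk_eq_zero] at h
    obtain ⟨h₁, h₂⟩ := h
    -- the two mixed solutions `(aᵢ, b_k, c_j)` and `(a_j, bᵢ, c_k)`
    have τ1 : ai + bk + cj = 0 := by rw [← h₁]; abel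
    have τ2 : aj + bi + ck = 0 := by rw [← h₂]; abel
    -- system 1 at `(a_j, b_k)`: `(aᵢ, b_j, c_j) = (a_k, bᵢ, c_k)`
    have e1 := sys₁_eq h1 haj hbk (x := (ai, bj, cj)) (y := (ak, bi, ck))
      ⟨hai, hbj, hcj⟩ hsj τ1 ⟨hak, hbi, hck⟩ τ2 hsk
    simp only [Prod.mk.injEq] at e1
    obtain ⟨eik, ebji, ecjk⟩ := e1
    -- system 1 at `(aᵢ, bᵢ)`: `(aᵢ, bᵢ, cᵢ) = (a_j, b_k, c_j)`
    have e2 := sys₁_eq h1 hai hbi (x := (ai, bi, ci)) (y := (aj, bk, cj))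
      ⟨hai, hbi, hci⟩ hsi hsi ⟨haj, hbk, hcj⟩ τ1 (by rw [ecjk]; exact τ2)
    simp only [Prod.mk.injEq] at e2
    obtain ⟨eij, ebik, -⟩ := e2
    have hcij : ci = cj := by
      have h' := τ1
      rw [← ebik] at h'
      exact add_left_cancel (hsi.trans h'.symm)
    have hcjk : cj = ck := ecjk
    refine ⟨Subtype.ext ?_, Subtype.ext ?_⟩
    · simp only [Prod.mk.injEq]
      exact ⟨eij, ebji.symm, hcij⟩
    · simp only [Prod.mk.injEq]
      exact ⟨eij.symm.trans eik, by rw [ebji, ebik], hcjk⟩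
  · rintro ⟨hij, hjk⟩
    have e1 := congrArg Subtype.val hij
    have e2 := congrArg Subtype.val hjk
    simp only [Prod.mk.injEq] at e1 e2
    obtain ⟨rfl, rfl, rfl⟩ := e1
    obtain ⟨rfl, rfl, rfl⟩ := e2
    simp only [Prod.mk_add_mk, Prod.mk_eq_zero]
    constructor
    · rw [← hsi]; abel
    · rw [← hsi]; abel

/-- **Transfer of tricolored bounds.**  Under system 1, any bound `M` valid for all tricolored
sum-free sets in `G × G` indexed by finite types bounds the number of solutions:
`#zeroSumTriples A B C ≤ M`.  (Quantitatively void with the slice-rank bounds, see the module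
docstring; recorded as the formal link between Pratt's `Val` and the tricolored world.) -/
theorem card_zeroSumTriples_le_of_tsf_bound {A B C : Finset G}
    (h1 : ∀ a' ∈ A, ∀ b' ∈ B,
      #((A ×ˢ B ×ˢ C).filter fun t => a' + t.2.1 + t.2.2 = 0 ∧ t.1 + b' + t.2.2 = 0) ≤ 1)
    {M : ℕ}
    (hM : ∀ (ι : Type u) [Fintype ι] (s t u : ι → G × G), IsTricoloredSumFree s t u →
      Fintype.card ι ≤ M) :
    #(zeroSumTriples A B C) ≤ M := by
  have := hM (zeroSumTriples A B C) _ _ _ (isTricoloredSumFree h1)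
  simpa using this

/-- The same for an equilateral trapezoid-free triple (all three systems; only the first is
used) and hence for `Val(G)`: `Val(G) ≤ M` for every tricolored bound `M` on `G × G`. -/
theorem prattVal_le_of_tsf_bound [Fintype G] {M : ℕ}
    (hM : ∀ (ι : Type u) [Fintype ι] (s t u : ι → G × G), IsTricoloredSumFree s t u →
      Fintype.card ι ≤ M) :
    prattVal G ≤ M := by
  obtain ⟨A, B, C, h, hk⟩ := exists_prattVal_eq (G := G)
  rw [← hk]
  exact card_zeroSumTriples_le_of_tsf_bound h.1 hM

end PrattValTricolored

end Summit.MatrixMultiplication.MatrixMultiplication.Theorems
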